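import Summits.PneNP.PneNP.Theses.CanonicalForms
import Literature.Computability.Complexity.EquivalenceProblemsCollapseProofs

/-!
# Crux `PEqNotCF` (stmt-PneNP-0947) — line `ker_bridge` (the route's second engine, formal edge recorded)

`X = CF ≠ PEq` from the route's rank-4 crux `KerNotCF` (= Fortnow–Grochow's `CF ≠ Ker`, OQ 5.6; stmt-PneNP-0950)
through the PROVED inclusion `Ker(FP) ⊆ PEq` (`Literature.Computability.Complexity.KerFP_subset_PEq`). This is the
"canonical forms are samplers" engine's route to the target (the sampler ladder KerNC0NotCFAC0 ⊂ KerAC0NotCFParity ⊂ … ⊂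
KerNotCF climbs toward its first stub). Filed as an ALTERNATIVE LINE, not as the split (one active decomposition per
node: the split is `nf_witness_split`); recorded so that a proof of stmt-PneNP-0950 closes this crux mechanically.

* `stub_kerNotCF` — VERBATIM the existing crux `Summit.PneNP.PneNP.Theses.CanonicalForms.KerNotCF` (OPEN; its only known
  plans are crypto/structural ladders with PROVED bridges: FACT ∉ ZPP — `fortnowGrochow_CF_eq_Ker_factoring_holds`;
  NP ≠ UP — `fortnowGrochow_CF_eq_Ker_NP_eq_UP_holds`; see STRATEGY-CENSUS.md D2–D4);
* `stub_kerPEq` — "every `FP`-kernel relation is a `P`-decidable equivalence relation", PROVED here from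
  `KerFP_subset_PEq` (no `sorry`);
* `PEqNotCF_of : PEqNotCF` — kernel-checked composition (the witness is the kernel relation of the `f` of stub 1).
-/

set_option linter.dupNamespace false

namespace Summit.PneNP.PneNP.Cruxes.PEqNotCF.KerBridge

open Summit.PneNP.PneNP.Theses.CanonicalForms
open Literature.Computability.Complexity

/-- **stub (OPEN — the existing crux `KerNotCF`, stmt-PneNP-0950, verbatim)**: some `f ∈ FP` has no `FP` canonical form
for its kernel (`CF(FP) ≠ Ker(FP)`). -/
theorem stub_kerNotCF :
    ∃ f ∈ Literature.Computability.Complexity.FP, ¬ ∃ c ∈ Literature.Computability.Complexity.FP, (∀ x, f (c x) = f x) ∧ ∀ x y, f x = f y → c x = c y := by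
  sorry

/-- **stub (PROVED, no `sorry`)**: the kernel relation of any `f ∈ FP` is an equivalence relation whose pair-language is
in `P` — `KerFP_subset_PEq` with the complete invariant `f` (`Iff.rfl`). [FG 2011 §1: "Ker ⊆ PEq"] -/
theorem stub_kerPEq :
    ∀ f ∈ Literature.Computability.Complexity.FP, Equivalence (fun x y : List Bool => f x = f y) ∧ ({w | ∃ x y, w = Literature.Computability.Complexity.boolPair x y ∧ (fun x y : List Bool => f x = f y) x y} : Language Bool) ∈ Literature.Computability.Complexity.Classes.P := by
  intro f hf
  exact KerFP_subset_PEq ⟨f, hf, fun x y => Iff.rfl⟩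

/-- **Seam (sorry-free)**: the two stub statements give the crux's BODY — the kernel relation of the `f` of stub 1 is
the witness. -/
theorem pEqNotCF_of_sigs :
    (∃ f ∈ Literature.Computability.Complexity.FP, ¬ ∃ c ∈ Literature.Computability.Complexity.FP, (∀ x, f (c x) = f x) ∧ ∀ x y, f x = f y → c x = c y) →
    (∀ f ∈ Literature.Computability.Complexity.FP, Equivalence (fun x y : List Bool => f x = f y) ∧ ({w | ∃ x y, w = Literature.Computability.Complexity.boolPair x y ∧ (fun x y : List Bool => f x = f y) x y} : Language Bool) ∈ Literature.Computability.Complexity.Classes.P) →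
    (∃ E : List Bool → List Bool → Prop, Equivalence E ∧ ({w | ∃ x y, w = Literature.Computability.Complexity.boolPair x y ∧ E x y} : Language Bool) ∈ Literature.Computability.Complexity.Classes.P ∧ ¬ ∃ c ∈ Literature.Computability.Complexity.FP, (∀ x, E (c x) x) ∧ ∀ x y, E x y → c x = c y) := by
  rintro ⟨f, hf, hno⟩ hsub
  obtain ⟨hEq, hP⟩ := hsub f hf
  exact ⟨fun x y => f x = f y, hEq, hP, hno⟩

/-- **Composition (kernel-checked): the crux `PEqNotCF` BY NAME from the two declared stubs** (only `stub_kerNotCF` is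
`sorry`d). -/
theorem PEqNotCF_of : PEqNotCF :=
  pEqNotCF_of_sigs stub_kerNotCF stub_kerPEq

/-- Sanity: stub 1 is literally the route decl `KerNotCF`. -/
example : (∃ f ∈ Literature.Computability.Complexity.FP, ¬ ∃ c ∈ Literature.Computability.Complexity.FP, (∀ x, f (c x) = f x) ∧ ∀ x y, f x = f y → c x = c y) ↔ KerNotCF := Iff.rfl

end Summit.PneNP.PneNP.Cruxes.PEqNotCF.KerBridge
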